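import Mathlib
import HarnessLib
import Summits.AtomisticToContinuum.HydrodynamicLimit.Theses.OneFlightGossipEngine
import Literature.MathematicalPhysics.KineticTheory.HardSphereEulerProofs
import Literature.MathematicalPhysics.KineticTheory.CollisionTubePullbackFlight
import Literature.Analysis.FluidPDE.HardSphereCollisionEnumeration
import Literature.Analysis.FluidPDE.LoadedCollisionRecordMeasurable

/-!
# `OneFlightGossipEngine.KineticCurrentsWindowLDUniform` (stmt-AtomisticToContinuum-14662), line
`gossip-forecast-ledger`, stub `stub_kickFiltration`: the group kick filtration is Borel and the
window functional of a half is a.e. measurable for its limit σ-algebra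

For a hard-sphere flow `Φ` on `𝕋³`, a set of particles `S` and a good datum `z`, let
`T(z) = ⋃_{i ∈ S} {collision times of i}` be the group collision times of the orbit of `z`,
`t_k(z) = nthTimeAfter (T z) 0 k` the `k`-th of them after `0` (junk `0` off the good set and past
the last one) and `ℱ_n = σ(z_S(0), (t_k, z_S(t_k))_{k<n})` the **group kick filtration**. We prove:

* every `ℱ_n` is a sub-σ-algebra of the Borel σ-algebra: `z ↦ t_k(z)` is measurable on the good
  set — `T(z)` is the zero set of the product over `i ∈ S` of the participation gauges
  `contactGauge` of the orbit, continuous in time and measurable in the datum, so the hitting-time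
  lemma `measurable_nextTimeAfter_setOf_eq_zero` applies inductively — and `z ↦ Φ_{t_k(z)} z` is
  measurable by joint measurability of the flow (`HardSphereFlow.measurable_flow_prod_torus`);
* the window functional `X_S(z) = Σ_{i∈S} w⁻¹ ∫₀ʷ F((Φ_r z)_i) dr` is a.e. equal, for every law
  carried by the good set, to a `⨆ n, ℱ_n`-measurable function: a particle of `S` takes part in no
  collision between consecutive group collision times, so it flies freely there
  (`apply_eq_translate_of_forall_not_participates`) and `(Φ_r z)_i` is an explicit Borel function
  (free flight from the last revealed time `≤ r`) of the revealed data
  `(z_S(0), (t_k, z_S(t_k))_k)` and `r`; hence `X_S = H ∘ (revealed data)` on the good set with `H`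
  Borel (parametric integrals, `StronglyMeasurable.integral_prod_right'`).

The local Gibbs law is carried by the good set (`localGibbsLaw_eq`,
`localGibbsMeasure_absolutelyContinuous`, `HardSphereFlow.measure_compl_good`). No new
definitions: the last revealed slot is produced by the existence lemma `exists_lastSelection` of
the sub-namespace `KickFiltration`. References: Gallagher–Saint-Raymond–Texier, *From Newton to
Boltzmann* (2013), §4.1; Brémaud, *Probability Theory and Stochastic Processes* (2020), Thm. 13.2.4.
-/

noncomputable section

open MeasureTheory Set Filter InformationTheory
open scoped ENNReal Topology Classical ProbabilityTheory

namespace Summit.AtomisticToContinuum.HydrodynamicLimit.Theorems.KineticCurrentsWindowLDUniformGossip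

open Literature.Analysis.FluidPDE (HardSphereFlow Config localMaxwellian collisionTimesOf nthTimeAfter)
open Literature.MathematicalPhysics.KineticTheory (T3 V3 hsDiameter localGibbsLaw)
open Summit.AtomisticToContinuum.HydrodynamicLimit.Theses.OneFlightGossipEngine (KineticCurrentsWindowLDUniform)

namespace KickFiltration

open Literature.Analysis.FluidPDE
open Literature.MathematicalPhysics.KineticTheory (apply_eq_translate_of_forall_not_participates)

/-! ### Revealed data: the last revealed time before `r` and the state revealed then

Revealed data with group-state space `Y` live in `Y × (ℕ → ℝ × Y)`: the initial group state and a
sequence of slots `(t_k, group state at t_k)`; below `Y = (S → 𝕋³ × ℝ³)`. -/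

/-- **A measurable last-slot selection.** On `(Y × (ℕ → ℝ × Y)) × ℝ` (revealed data and a time `r`)
there are a measurable time `L` and a measurable state `sel` such that, whenever only finitely
many slot times lie in `(0, r]`, `L` dominates every slot time in `(0, r]` and either `L = 0` and
`sel` is the initial state, or `L` is the time of a slot in `(0, r]` and `sel` is its state.
(`L` = the countable supremum of the slot times in `(0, r]`; `sel` = a measurable selection,
`Measurable.find`, of a slot carrying the time `L`.) -/
theorem exists_lastSelection (Y : Type*) [MeasurableSpace Y] :
    ∃ (L : (Y × (ℕ → ℝ × Y)) × ℝ → ℝ) (sel : (Y × (ℕ → ℝ × Y)) × ℝ → Y),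
      Measurable L ∧ Measurable sel ∧ ∀ p : (Y × (ℕ → ℝ × Y)) × ℝ,
        {x : ℝ | ∃ k, (0 < (p.1.2 k).1 ∧ (p.1.2 k).1 ≤ p.2) ∧ (p.1.2 k).1 = x}.Finite →
        (∀ k, 0 < (p.1.2 k).1 → (p.1.2 k).1 ≤ p.2 → (p.1.2 k).1 ≤ L p) ∧
        ((L p = 0 ∧ sel p = p.1.1) ∨ ∃ k,
          (0 < (p.1.2 k).1 ∧ (p.1.2 k).1 ≤ p.2) ∧ (p.1.2 k).1 = L p ∧ sel p = (p.1.2 k).2) := by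
  -- slot `k` counts when its time lies in `(0, r]`; `L` = the last revealed time `≤ r`
  let C : (Y × (ℕ → ℝ × Y)) × ℝ → ℕ → Prop := fun p k => 0 < (p.1.2 k).1 ∧ (p.1.2 k).1 ≤ p.2
  let L : (Y × (ℕ → ℝ × Y)) × ℝ → ℝ := fun p => ⨆ k, if C p k then (p.1.2 k).1 else 0
  -- selection events: index `k + 1` ↔ slot `k` carries the time `L`; index `0` ↔ no slot does
  let ev : ℕ → Set ((Y × (ℕ → ℝ × Y)) × ℝ) := fun n =>
    Nat.casesOn (motive := fun _ => Set ((Y × (ℕ → ℝ × Y)) × ℝ)) n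
      {p | ¬ ∃ k, C p k ∧ (p.1.2 k).1 = L p} (fun k => {p | C p k ∧ (p.1.2 k).1 = L p})
  have hex : ∀ p, ∃ n, p ∈ ev n := fun p => by
    by_cases h : ∃ k, C p k ∧ (p.1.2 k).1 = L p
    · obtain ⟨k, hk⟩ := h
      exact ⟨k + 1, hk⟩
    · exact ⟨0, h⟩
  -- the state stored at a selection index
  let st : (Y × (ℕ → ℝ × Y)) × ℝ → ℕ → Y := fun p n =>
    Nat.casesOn (motive := fun _ => Y) n p.1.1 (fun k => (p.1.2 k).2)
  have hT : ∀ k, Measurable fun p : (Y × (ℕ → ℝ × Y)) × ℝ => (p.1.2 k).1 := fun k =>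
    ((measurable_pi_apply k).comp measurable_fst.snd).fst
  have hC : ∀ k, MeasurableSet {p : (Y × (ℕ → ℝ × Y)) × ℝ | C p k} := fun k =>
    (measurableSet_lt measurable_const (hT k)).inter (measurableSet_le (hT k) measurable_snd)
  have hL : Measurable L := Measurable.iSup fun k => Measurable.ite (hC k) (hT k) measurable_const
  have hS : ∀ k, MeasurableSet {p : (Y × (ℕ → ℝ × Y)) × ℝ | C p k ∧ (p.1.2 k).1 = L p} :=
    fun k => (hC k).inter (measurableSet_eq_fun (hT k) hL)
  have hev : ∀ n, MeasurableSet (ev n) := by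
    intro n
    cases n with
    | zero =>
      show MeasurableSet {p : (Y × (ℕ → ℝ × Y)) × ℝ | ¬ ∃ k, C p k ∧ (p.1.2 k).1 = L p}
      rw [show {p : (Y × (ℕ → ℝ × Y)) × ℝ | ¬ ∃ k, C p k ∧ (p.1.2 k).1 = L p} =
          (⋃ k, {p : (Y × (ℕ → ℝ × Y)) × ℝ | C p k ∧ (p.1.2 k).1 = L p})ᶜ from by
        ext p
        simp only [mem_setOf_eq, mem_compl_iff, mem_iUnion, not_exists]]
      exact (MeasurableSet.iUnion hS).compl
    | succ k => exact hS k
  have hst : ∀ n, Measurable fun p => st p n := by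
    intro n
    cases n with
    | zero => exact measurable_fst.fst
    | succ k => exact ((measurable_pi_apply k).comp measurable_fst.snd).snd
  refine ⟨L, fun p => st p (Nat.find (hex p)), hL,
    Measurable.find (f := fun n p => st p n) (p := fun n p => p ∈ ev n) hst hev hex,
    fun p hfin => ?_⟩
  -- the last revealed time is attained: it is `0` or a slot time in `(0, r]`, and dominates them
  have hrange : range (fun k => if C p k then (p.1.2 k).1 else 0) ⊆
      insert 0 {x : ℝ | ∃ k, (0 < (p.1.2 k).1 ∧ (p.1.2 k).1 ≤ p.2) ∧ (p.1.2 k).1 = x} := by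
    rintro x ⟨k, rfl⟩
    by_cases hk : C p k
    · exact mem_insert_of_mem _ ⟨k, hk, (if_pos hk).symm⟩
    · exact mem_insert_iff.2 (Or.inl (if_neg hk))
  have hfin' := (hfin.insert 0).subset hrange
  have hlast : L p = 0 ∨ ∃ k, C p k ∧ (p.1.2 k).1 = L p := by
    obtain ⟨k, hk⟩ : L p ∈ range (fun k => if C p k then (p.1.2 k).1 else 0) :=
      (range_nonempty _).csSup_mem hfin'
    by_cases hc : C p k
    · exact Or.inr ⟨k, hc, by rw [← hk]; exact (if_pos hc).symm⟩
    · exact Or.inl (by rw [← hk]; exact if_neg hc)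
  refine ⟨fun k h1 h2 => ?_, ?_⟩
  · have h := le_ciSup hfin'.bddAbove k
    rwa [show (if C p k then (p.1.2 k).1 else 0) = (p.1.2 k).1 from if_pos ⟨h1, h2⟩] at h
  -- identify the selected state
  obtain ⟨n, hn⟩ : ∃ n, Nat.find (hex p) = n := ⟨_, rfl⟩
  have hspec : p ∈ ev n := hn ▸ Nat.find_spec (hex p)
  have hsel : st p (Nat.find (hex p)) = st p n := by rw [hn]
  cases n with
  | zero =>
    have hspec' : ¬ ∃ k, C p k ∧ (p.1.2 k).1 = L p := hspec
    exact Or.inl ⟨hlast.elim id fun h => absurd h hspec', hsel⟩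
  | succ k =>
    have hspec' : C p k ∧ (p.1.2 k).1 = L p := hspec
    exact Or.inr ⟨k, hspec'.1, hspec'.2, hsel⟩

/-! ### Along a good orbit the reconstruction is exact; the group collision times are measurable -/

variable {N : ℕ} {ε : ℝ}

/-- **Reconstruction from the revealed data.** On a good orbit, for `r ≥ 0` and a particle `i` of
the group `S`, feed a last-slot selection `(L, sel)` as in `exists_lastSelection` with the revealed
data `(z_S, (t_k, (Φ_{t_k} z)_S)_k)` of the group kick times `t_k` and the time `r`: then free
flight over the time `r - L` from the selected state of `i` reproduces `(Φ_r z)_i` — the selected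
time `s ≤ r` is `0` or a group collision time, no group collision happens in `(s, r]`, and a
particle of `S` that takes part in no collision flies freely. -/
theorem flow_eq_translate_sel (Φ : HardSphereFlow (Torus.geometry (Fin 3)) ε N) (S : Finset (Fin N))
    {z : Config N (Fin 3) T3} (hz : z ∈ Φ.good) {t : ℕ → ℝ}
    (ht : ∀ k, t k = nthTimeAfter
      (⋃ i ∈ S, collisionTimesOf (Torus.geometry (Fin 3)) ε (fun s => Φ.flow s z) i) 0 k)
    {r : ℝ} (hr : 0 ≤ r) {L : ((S → T3 × V3) × (ℕ → ℝ × (S → T3 × V3))) × ℝ → ℝ}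
    {sel : ((S → T3 × V3) × (ℕ → ℝ × (S → T3 × V3))) × ℝ → S → T3 × V3}
    {p : ((S → T3 × V3) × (ℕ → ℝ × (S → T3 × V3))) × ℝ}
    (hL : {x : ℝ | ∃ k, (0 < (p.1.2 k).1 ∧ (p.1.2 k).1 ≤ p.2) ∧ (p.1.2 k).1 = x}.Finite →
      (∀ k, 0 < (p.1.2 k).1 → (p.1.2 k).1 ≤ p.2 → (p.1.2 k).1 ≤ L p) ∧
      ((L p = 0 ∧ sel p = p.1.1) ∨
        ∃ k, (0 < (p.1.2 k).1 ∧ (p.1.2 k).1 ≤ p.2) ∧ (p.1.2 k).1 = L p ∧ sel p = (p.1.2 k).2))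
    (hp : p = ((fun j : S => z j.1, fun k => (t k, fun j : S => Φ.flow (t k) z j.1)), r)) (i : S) :
    Φ.flow r z i.1 = ((Torus.geometry (Fin 3)).translate (sel p i).1 ((r - L p) • (sel p i).2),
      (sel p i).2) := by
  set T : Set ℝ := ⋃ i ∈ S, collisionTimesOf (Torus.geometry (Fin 3)) ε (fun s => Φ.flow s z) i
  have hγ := Φ.isTrajectory z hz
  -- the group collision times are locally finite; enumerated times are in `T` or junk `0`
  have hTfin : ∀ a b, (T ∩ Ioc a b).Finite := fun a b =>
    (hγ.finite_collisionTimes_inter_of_subset_Icc Ioc_subset_Icc_self).subset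
      (inter_subset_inter_left _ (iUnion₂_subset fun i _ => collisionTimesOf_subset _ i))
  have htk : ∀ k, t k ∈ T ∨ t k = 0 := by
    intro k
    rw [ht k, nthTimeAfter, Function.iterate_succ_apply']
    by_cases hne : (T ∩ Ioi ((nextTimeAfter T)^[k] 0)).Nonempty
    · exact Or.inl (nextTimeAfter_mem (hTfin _) hne)
    · exact Or.inr (nextTimeAfter_of_eq_empty (not_nonempty_iff_eq_empty.1 hne))
  have hslot : ∀ k, (p.1.2 k).1 = t k := fun k => by rw [hp]
  have hp2 : p.2 = r := by rw [hp]
  have hfin : {x : ℝ | ∃ k, (0 < (p.1.2 k).1 ∧ (p.1.2 k).1 ≤ p.2) ∧ (p.1.2 k).1 = x}.Finite := by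
    refine (hTfin 0 r).subset ?_
    rintro x ⟨k, ⟨h1, h2⟩, rfl⟩
    rw [hslot, hp2] at *
    exact ⟨(htk k).resolve_right h1.ne', h1, h2⟩
  obtain ⟨hdom, hsel⟩ := hL hfin
  set s := L p
  have hs0r : 0 ≤ s ∧ s ≤ r := by
    rcases hsel with ⟨h0, -⟩ | ⟨k, ⟨h1, h2⟩, hk, -⟩
    · rw [h0]; exact ⟨le_rfl, hr⟩
    · rw [← hk, ← hp2]; exact ⟨h1.le, h2⟩
  -- no group collision in `(s, r]`
  have hnoT : ∀ u ∈ Ioc s r, u ∉ T := by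
    intro u hu huT
    obtain ⟨m, hm⟩ := exists_nthTimeAfter_eq hTfin huT (hs0r.1.trans_lt hu.1)
    have htm : (p.1.2 m).1 = u := by rw [hslot, ht m]; exact hm
    have hle : u ≤ s := by
      have := hdom m (by rw [htm]; exact hs0r.1.trans_lt hu.1) (by rw [htm, hp2]; exact hu.2)
      rwa [htm] at this
    exact (not_lt.2 hle) hu.1
  -- the selected state is the orbit at time `s`
  have hstate : sel p i = Φ.flow s z i.1 := by
    rcases hsel with ⟨h0, hy⟩ | ⟨k, -, hk, hy⟩
    · rw [hy, h0, Φ.flow_zero z hz, hp]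
    · rw [hy, ← hk, hslot, hp]
  -- free flight of `i` on `[s, r]`
  rw [apply_eq_translate_of_forall_not_participates hγ Torus.continuous_geometry_translate
    i.1 hs0r.2 (fun u hu hpart => hnoT u hu (mem_iUnion₂.2 ⟨i.1, i.2, hpart⟩)), hstate]

/-- **The `k`-th group collision time is measurable on the good set**: the group collision times
of a good orbit are the zero set of the product of the participation gauges of the particles of
`S`, continuous in time and measurable in the datum, so the hitting-time lemma applies inductively
along `nthTimeAfter`. -/
theorem measurable_nthTimeAfter_group (Φ : HardSphereFlow (Torus.geometry (Fin 3)) ε N)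
    (S : Finset (Fin N)) (k : ℕ) :
    Measurable fun z : Φ.good => nthTimeAfter
      (⋃ i ∈ S, collisionTimesOf (Torus.geometry (Fin 3)) ε
        (fun s => Φ.flow s (z : Config N (Fin 3) T3)) i) 0 k := by
  have hGc : Continuous fun q : T3 × T3 => ‖(Torus.geometry (Fin 3)).sepVec q.1 q.2‖ :=
    Torus.continuous_euclidDist
  -- the group gauge of a good orbit
  set f : Φ.good → ℝ → ℝ := fun z s => ∏ i ∈ S,
    contactGauge (Torus.geometry (Fin 3)) ε i (fun l => (Φ.flow s (z : Config N (Fin 3) T3) l).1)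
    with hfdef
  have hc : ∀ z, Continuous (f z) := fun z =>
    continuous_finsetProd S fun i _ => (continuous_contactGauge hGc i).comp
      (continuous_pi fun l => (Φ.isTrajectory _ z.2).pos_continuous l)
  have hm : ∀ s, Measurable fun z => f z s := fun s =>
    Finset.measurable_prod S fun i _ =>
      (measurable_contactGauge (Torus.measurable_geometry_sepVec (d := Fin 3)) i).comp
        ((measurable_pi_lambda _ fun l => (measurable_pi_apply l).fst).comp
          ((Φ.measurable_flow s).comp measurable_subtype_coe))
  have hT : ∀ z : Φ.good, (⋃ i ∈ S, collisionTimesOf (Torus.geometry (Fin 3)) ε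
      (fun s => Φ.flow s (z : Config N (Fin 3) T3)) i) = {s | f z s = 0} := by
    intro z
    ext s
    simp only [mem_iUnion, mem_collisionTimesOf, mem_setOf_eq, hfdef, Finset.prod_eq_zero_iff,
      exists_prop]
    exact exists_congr fun i => and_congr_right fun _ =>
      (contactGauge_eq_zero_iff ((Φ.isTrajectory _ z.2).mem s) i).symm
  simp_rw [hT]
  induction k with
  | zero =>
    simp_rw [nthTimeAfter_zero]
    exact measurable_nextTimeAfter_setOf_eq_zero hc hm measurable_const
  | succ k ih =>
    simp_rw [nthTimeAfter_succ]
    exact measurable_nextTimeAfter_setOf_eq_zero hc hm ih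

/-- **The two facts, for a general law carried by the good set.** With `t_k` the `k`-th group
collision time after `0` (junk `0` off the good set) and `ℱ_n = σ(z_S, (t_k, (Φ_{t_k} z)_S)_{k<n})`:
every `ℱ_n` is a sub-σ-algebra of the Borel σ-algebra, and the window functional
`Σ_{i∈S} w⁻¹ ∫₀ʷ F((Φ_r z)_i) dr` (`F` continuous, `w ≥ 0`) is a.e. strongly measurable for
`⨆ n, ℱ_n` under every measure `μ` with `μ goodᶜ = 0`. -/
theorem main (Φ : HardSphereFlow (Torus.geometry (Fin 3)) ε N) {F : T3 × V3 → ℝ}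
    (hF : Continuous F) {w : ℝ} (hw : 0 ≤ w) (S : Finset (Fin N))
    {μ : Measure (Config N (Fin 3) T3)} (hμ : μ Φ.goodᶜ = 0) {tk : ℕ → Config N (Fin 3) T3 → ℝ}
    (htk : ∀ k, ∀ z ∈ Φ.good, tk k z = nthTimeAfter
      (⋃ i ∈ S, collisionTimesOf (Torus.geometry (Fin 3)) ε (fun s => Φ.flow s z) i) 0 k)
    (htk' : ∀ k, ∀ z ∉ Φ.good, tk k z = 0) {ℱ : ℕ → MeasurableSpace (Config N (Fin 3) T3)}
    (hℱ : ∀ n, ℱ n =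
      MeasurableSpace.comap (fun (z : Config N (Fin 3) T3) (i : S) => z i.1) inferInstance ⊔
        ⨆ k < n, MeasurableSpace.comap (fun (z : Config N (Fin 3) T3) =>
          (tk k z, fun i : S => Φ.flow (tk k z) z i.1)) inferInstance) :
    (∀ n, ℱ n ≤ (inferInstance : MeasurableSpace (Config N (Fin 3) T3))) ∧
      AEStronglyMeasurable[⨆ n, ℱ n]
        (fun z => ∑ i ∈ S, w⁻¹ * ∫ r in (0 : ℝ)..w, F ((Φ.flow r z) i)) μ := by
  -- (a) the revealed coordinates are Borel measurable
  have htk_good : ∀ k, Measurable fun z : Φ.good => tk k (z : Config N (Fin 3) T3) := by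
    intro k
    have h : (fun z : Φ.good => tk k (z : Config N (Fin 3) T3)) = fun z : Φ.good => nthTimeAfter
        (⋃ i ∈ S, collisionTimesOf (Torus.geometry (Fin 3)) ε
          (fun s => Φ.flow s (z : Config N (Fin 3) T3)) i) 0 k :=
      funext fun z => htk k z z.2
    rw [h]
    exact measurable_nthTimeAfter_group Φ S k
  have htk_meas : ∀ k, Measurable (tk k) := fun k =>
    measurable_of_restrict_of_restrict_compl Φ.measurableSet_good (htk_good k) (by
      rw [show Φ.goodᶜ.restrict (tk k) = fun _ => 0 from funext fun z => htk' k z z.2]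
      exact measurable_const)
  have hflow_meas : ∀ k, Measurable fun z => Φ.flow (tk k z) z := fun k =>
    measurable_of_restrict_of_restrict_compl Φ.measurableSet_good
      (Φ.measurable_flow_prod_torus.comp (measurable_id.prodMk (htk_good k))) (by
      have h : Φ.goodᶜ.restrict (fun z => Φ.flow (tk k z) z) =
          fun z : (Φ.goodᶜ : Set _) => Φ.flow 0 (z : Config N (Fin 3) T3) :=
        funext fun z => by simp only [restrict_apply, htk' k z z.2]
      rw [h]
      exact (Φ.measurable_flow 0).comp measurable_subtype_coe)
  have hρ : ∀ k, Measurable fun z => (tk k z, fun i : S => Φ.flow (tk k z) z i.1) := fun k =>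
    (htk_meas k).prodMk
      (measurable_pi_lambda _ fun i => (measurable_pi_apply i.1).comp (hflow_meas k))
  have hπ : Measurable fun (z : Config N (Fin 3) T3) (i : S) => z i.1 :=
    measurable_pi_lambda _ fun i => measurable_pi_apply i.1
  refine ⟨fun n => ?_, ?_⟩
  · rw [hℱ n]
    exact sup_le hπ.comap_le (iSup₂_le fun k _ => (hρ k).comap_le)
  -- (b) the revealed-data map is measurable for the limit σ-algebra
  set mI : MeasurableSpace (Config N (Fin 3) T3) := ⨆ n, ℱ n
  have hrev : Measurable[mI] fun z : Config N (Fin 3) T3 =>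
      ((fun i : S => z i.1, fun k => (tk k z, fun i : S => Φ.flow (tk k z) z i.1)) :
        (↥S → T3 × V3) × (ℕ → ℝ × (↥S → T3 × V3))) := by
    refine Measurable.prodMk ((comap_measurable _).mono ?_ le_rfl)
      (measurable_pi_lambda _ fun k => (comap_measurable _).mono ?_ le_rfl)
    · exact le_trans (by rw [hℱ 1]; exact le_sup_left) (le_iSup ℱ 1)
    · refine le_trans ?_ (le_iSup ℱ (k + 1))
      rw [hℱ (k + 1)]
      refine le_trans ?_ le_sup_right
      exact le_iSup₂_of_le (f := fun k' (_ : k' < k + 1) => MeasurableSpace.comap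
        (fun (z : Config N (Fin 3) T3) => (tk k' z, fun i : S => Φ.flow (tk k' z) z i.1))
          inferInstance) k (Nat.lt_succ_self k) le_rfl
  -- the Borel functional of the revealed data: window integrals of `F` along the reconstruction
  obtain ⟨L, sel, hLm, hselm, hLs⟩ := exists_lastSelection (↥S → T3 × V3)
  set R : ((↥S → T3 × V3) × (ℕ → ℝ × (↥S → T3 × V3))) × ℝ → ↥S → T3 × V3 := fun q i =>
    ((Torus.geometry (Fin 3)).translate (sel q i).1 ((q.2 - L q) • (sel q i).2), (sel q i).2)
    with hRdef
  have hRm : ∀ i, Measurable fun q => R q i := fun i => by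
    have hc : Continuous fun q : (T3 × V3) × ℝ =>
        ((Torus.geometry (Fin 3)).translate q.1.1 (q.2 • q.1.2), q.1.2) := by
      simp only [Torus.geometry_translate]
      exact (continuous_fst.fst.add (Literature.Analysis.FunctionSpaces.Torus.continuous_proj.comp
        (continuous_snd.smul continuous_fst.snd))).prodMk continuous_fst.snd
    exact hc.measurable.comp
      (((measurable_pi_apply i).comp hselm).prodMk (measurable_snd.sub hLm))
  set H : (↥S → T3 × V3) × (ℕ → ℝ × (↥S → T3 × V3)) → ℝ := fun ω =>
    ∑ i : S, w⁻¹ * ∫ r in (0 : ℝ)..w, F (R (ω, r) i) with hHdef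
  have hH : Measurable H := by
    refine Finset.measurable_sum _ fun i _ => Measurable.const_mul ?_ _
    have hint : StronglyMeasurable
        fun q : ((↥S → T3 × V3) × (ℕ → ℝ × (↥S → T3 × V3))) × ℝ => F (R q i) :=
      (hF.measurable.comp (hRm i)).stronglyMeasurable
    have h1 := (hint.integral_prod_right' (ν := volume.restrict (Ioc 0 w))).measurable
    have h2 := (hint.integral_prod_right' (ν := volume.restrict (Ioc w 0))).measurable
    simp only [intervalIntegral]
    exact h1.sub h2
  refine ⟨fun z => H ((fun i : S => z i.1, fun k => (tk k z, fun i : S => Φ.flow (tk k z) z i.1))),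
    (hH.comp hrev).stronglyMeasurable, ?_⟩
  -- a.e. equality on the good set
  have hae : ∀ᵐ z ∂μ, z ∈ Φ.good := by rw [ae_iff]; exact hμ
  filter_upwards [hae] with z hz
  simp only [hHdef]
  rw [← Finset.sum_coe_sort S]
  refine Finset.sum_congr rfl fun i _ => ?_
  congr 1
  refine intervalIntegral.integral_congr fun r hr => ?_
  rw [uIcc_of_le hw] at hr
  exact congrArg F (flow_eq_translate_sel Φ S hz (fun k => htk k z hz) hr.1 (hLs _) rfl i)

end KickFiltration

/-- S1 — the group kick filtration of a half `S` is Borel and the half's window functional is a.e. measurable for its limit σ-algebra (registered stub `stub_kickFiltration` of line `gossip-forecast-ledger`, crux stmt-AtomisticToContinuum-14662). [folklore] -/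
theorem stub_kickFiltration :
    ∀ σ : ℝ, 0 < σ → ∀ (a θ₀ : T3 → ℝ) (u₀ : T3 → V3) (N : ℕ)
      (Φ : HardSphereFlow (Literature.Analysis.FluidPDE.Torus.geometry (Fin 3)) (hsDiameter σ N) (N + 1))
      (F : T3 × V3 → ℝ), Continuous F → ∀ τ : ℝ, 0 < τ → ∀ S : Finset (Fin (N + 1)),
      let μ : Measure (Config (N + 1) (Fin 3) T3) := localGibbsLaw σ a u₀ θ₀ N Φ
      let X : Config (N + 1) (Fin 3) T3 → ℝ := fun z => ∑ i ∈ S, (τ * ((N : ℝ) + 1) ^ (-(1 / 3 : ℝ)))⁻¹ * ∫ r in (0 : ℝ)..(τ * ((N : ℝ) + 1) ^ (-(1 / 3 : ℝ))), F ((Φ.flow r z) i)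
      let T : Config (N + 1) (Fin 3) T3 → Set ℝ := fun z =>
        ⋃ i ∈ S, collisionTimesOf (Literature.Analysis.FluidPDE.Torus.geometry (Fin 3)) (hsDiameter σ N) (fun t => Φ.flow t z) i
      let tk : ℕ → Config (N + 1) (Fin 3) T3 → ℝ := fun k z => if z ∈ Φ.good then nthTimeAfter (T z) 0 k else 0
      let ℱ : ℕ → MeasurableSpace (Config (N + 1) (Fin 3) T3) := fun n =>
        MeasurableSpace.comap (fun (z : Config (N + 1) (Fin 3) T3) (i : S) => z i.1) inferInstance ⊔
          ⨆ k < n, MeasurableSpace.comap (fun (z : Config (N + 1) (Fin 3) T3) => (tk k z, fun i : S => Φ.flow (tk k z) z i.1))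
            inferInstance
      (∀ n, ℱ n ≤ (inferInstance : MeasurableSpace (Config (N + 1) (Fin 3) T3))) ∧
        AEStronglyMeasurable[⨆ n, ℱ n] X μ := by
  intro σ hσ a θ₀ u₀ N Φ F hF τ hτ S μ X T tk ℱ
  have hw : 0 ≤ τ * ((N : ℝ) + 1) ^ (-(1 / 3 : ℝ)) :=
    (mul_pos hτ (Real.rpow_pos_of_pos (by positivity) _)).le
  have hμ : μ Φ.goodᶜ = 0 := by
    show localGibbsLaw σ a u₀ θ₀ N Φ Φ.goodᶜ = 0
    rw [Literature.MathematicalPhysics.KineticTheory.localGibbsLaw_eq]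
    exact Literature.MathematicalPhysics.KineticTheory.localGibbsMeasure_absolutelyContinuous
      σ a u₀ θ₀ N Φ Φ.measure_compl_good
  exact KickFiltration.main Φ hF hw S hμ (tk := tk) (fun k z hz => if_pos hz)
    (fun k z hz => if_neg hz) (ℱ := ℱ) (fun n => rfl)

end Summit.AtomisticToContinuum.HydrodynamicLimit.Theorems.KineticCurrentsWindowLDUniformGossip

end
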